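import Mathlib
import HarnessLib
import Literature.MathematicalPhysics.QuantumLattice.SliceCutoffGramConstant
import Literature.MathematicalPhysics.QuantumLattice.SalmhoferCutoffDerivSharp
import Literature.MathematicalPhysics.QuantumLattice.HubbardSliceSymbolSmooth
import Summits.HubbardSuperconductivity.HubbardSuperconductivity.Theorems.KLProgrammeSalmhoferCutoffSecondDerivBound
import Summits.HubbardSuperconductivity.HubbardSuperconductivity.Theorems.KLProgrammeMatsubaraSliceWeight
import Summits.HubbardSuperconductivity.HubbardSuperconductivity.Theorems.KLProgrammeKLRegimeWickScaleFlowLines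
import Summits.HubbardSuperconductivity.HubbardSuperconductivity.Theorems.KLProgrammeKLRegimeEngineV8PairTransferExport2

/-!
# Route `KLProgramme` — ENGINE item stmt-HubbardSuperconductivity-20437 `KLRegimeEngineV17F2`, class-#5 STEP (X).3 rows form / (c) `hout` rows:
# THE CONTINUOUS FLOW'S LINE WEIGHTS MEET THE HYPOTHESES OF THE LATTICE PH-LOOP ROWS — the slice-derivative weight `ẇ_Λ` and the running
# partner symbol `Φ = w_{Λ_m} − w_{Λ(t)}` as functions of `s = ω² + e_K²`, at the scale index `n+1`, plus the propagator dictionary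
# (cell gate-hubbard-kl, seat hubbard-kl-k3c2-p2 g17, technique «thermal-bar induction n ≤ nScales β + 1»)

WHY.  The signed lattice ph-loop rows of this lineage (`klfl_lattice_forward_bubble_norm_le`, `klhl_lattice_soft_split_norm_le`,
`klhl_lattice_soft_signblind_norm_le`, …) are stated for ABSTRACT line weights `f d : ℝ → ℂ` of the radial variable `s = k₀² + e²` with four
hypotheses each (sup, Lipschitz `≤ ℓ/Λ²`, inner/outer support at the scale `Λ = klScale klE0 ·`) and for the abstract propagator `klfb_prop f k₀ e`.
The class-#5 STEP of 20437 (`klmd_defect_le_rows_family`, rows `hP hQ hS`) and stub (c)'s out-of-class rows carry instead the LITERAL weights of the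
continuous flow at `Λ(t) = Λₙ + t(Λₙ₊₁ − Λₙ) ∈ [Λₙ₊₁, Λₙ]`: the slice line `Wd t p = ∂_Λ w^K_Λ(p)|_{Λ(t)}` and the running partner
`Φ_j(t)(p) = s^K_{n+1,j}(p) + (w^K_{Λₙ₊₁}(p) − w^K_{Λ(t)}(p)) = w^K_{Λ_j}(p) − w^K_{Λ(t)}(p)`, against `propCT`.  This file is the dictionary:

* §1 `klWd Λ s = χ₂′(s/Λ²)·(−2s/Λ³)` (= `∂_Λ χ₂(s/Λ²)`, the normal form of `klws_deriv_cutoffWeight_scale_eq`): closed-endpoint support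
  `klWd Λ s = 0` for `s ≤ Λ²/4` and for `Λ² ≤ s`, sup `|klWd Λ s| ≤ 8/Λ` (`|χ₂′| ≤ 4`), derivative and the Lipschitz constant `(2B₂ + 8)/Λ³`
  (`B₂ = 448e²/3 ≥ |χ₂″|`); the model's `Wd` IS `klWd Λ(t) (ω² + e_K²)` (`klfw_Wd_eq_klWd`).
* §2 `klPhi Λm Λ s = χ₂(s/Λm²) − χ₂(s/Λ²)` (modes between `Λm ≤ Λ`): `0 ≤ klPhi ≤ 1`, support `(Λm²/4, Λ²)`, `8/Λm²`-Lipschitz; the model's member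
  symbol, `D`-line and complementary symbols ARE `klPhi` at `(Λ_j, Λ(t))`, `(Λ_j, Λ_{j′})`, `(Λ_m, Λ_n)` (`klfw_memberSymbol_eq`, `klfw_dLine_eq`,
  `klfw_softSymbolCompl_eq`); the deep/near split `klPhi Λ_j Λ(t) = klPhi Λ_j Λ_{n+2} + klPhi Λ_{n+2} Λ(t)` (`klPhi_split`).
* §3 AT THE ROWS' SCALE INDEX `n+1` (`Λ(t) ∈ [Λₙ₊₁, 4Λₙ₊₁]`, `scaleAt_mem`): the four slice-weight hypotheses for `f = klWdC Λ(t)` with `M_f = 8/Λₙ₊₁`,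
  `ℓ_f = (2B₂+8)/Λₙ₊₁` (`klfw_sliceWeight_hypotheses`), the partner hypotheses for `d = klPhiC Λ_m Λ(t)`, `n+1 ≤ m`, with `M′ = 1`,
  `L_d = 8/Λ_m² = 8·16^{m−n−1}/Λₙ₊₁²` (`klfw_partner_hypotheses`, `klfw_partner_lipschitz_scale`), and the product weight `f·d` (`klfw_product_hypotheses`).
(The propagator dictionary `klfb_prop f ω_i (e_K(k)) = f(ω_i² + e_K(k)²)·ĝ_K(i,k)` and the literal lines of the STEP follow in `…EngineFlowLineDictionary`.)

Pure analysis / rewriting; nothing about the model's effective action is asserted; nothing asserts (X).3, (c), K3 or superconductivity.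
References: Salmhofer 1999 §4.2.5 (4.70)–(4.71) [cite: Salmhofer1999]; BGM 2006 §2.4 [cite: BenfattoGiulianiMastropietro2006].
-/

noncomputable section

namespace Summit.HubbardSuperconductivity.HubbardSuperconductivity.Theorems.KLRegimeSplit

set_option linter.dupNamespace false -- summit = problem name (single-conjunct summit), D-0017

open Real Set Complex Literature.MathematicalPhysics.QuantumLattice Literature.Probability.LatticeModels
open Summit.HubbardSuperconductivity.HubbardSuperconductivity.Theorems.KLProgrammeLegKernels
open Summit.HubbardSuperconductivity.HubbardSuperconductivity.Theorems.KLRegimeWick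
open Summit.HubbardSuperconductivity.HubbardSuperconductivity.Theorems.TwoPointAssembly

/-! ## §0 Closed-endpoint vanishing of `χ₂′` -/

/-- `χ₂′(x) = 0` for `x ≤ ¼` (closed endpoint: `χ₂ ≥ 0 = χ₂(¼)` makes `¼` a minimum). -/
theorem klfw_deriv_salmhoferCutoff_eq_zero_of_le {x : ℝ} (hx : x ≤ 1 / 4) : deriv salmhoferCutoff x = 0 := by
  rcases hx.lt_or_eq with h | h
  · exact deriv_salmhoferCutoff_eq_zero_of_lt h
  · subst h
    refine IsLocalMin.deriv_eq_zero (Filter.Eventually.of_forall fun y => ?_)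
    rw [salmhoferCutoff_of_le le_rfl]
    exact (salmhoferCutoff_mem_Icc y).1

/-- `χ₂′(x) = 0` for `1 ≤ x` (closed endpoint: `χ₂ ≤ 1 = χ₂(1)` makes `1` a maximum). -/
theorem klfw_deriv_salmhoferCutoff_eq_zero_of_ge {x : ℝ} (hx : 1 ≤ x) : deriv salmhoferCutoff x = 0 := by
  rcases hx.lt_or_eq with h | h
  · exact deriv_salmhoferCutoff_eq_zero_of_gt h
  · subst h
    refine IsLocalMax.deriv_eq_zero (Filter.Eventually.of_forall fun y => ?_)
    rw [salmhoferCutoff_of_ge le_rfl]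
    exact (salmhoferCutoff_mem_Icc y).2

/-! ## §1 The slice-derivative weight `ẇ_Λ` as a function of `s = ω² + e²` -/

/-- **`klWd Λ s = χ₂′(s/Λ²)·(−2s/Λ³)`** — the scale derivative `∂_Λ χ₂(s/Λ²)` of Salmhofer's weight as a function of `s`. -/
def klWd (Λ s : ℝ) : ℝ := deriv salmhoferCutoff (s / Λ ^ 2) * (-(2 * s) / Λ ^ 3)

/-- The `ℂ`-valued copy (the lattice rows take `f : ℝ → ℂ`). -/
def klWdC (Λ : ℝ) (s : ℝ) : ℂ := ((klWd Λ s : ℝ) : ℂ)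

/-- `∂_Λ χ₂(s/Λ²) = klWd Λ s` (`Λ ≠ 0`). -/
theorem klfw_hasDerivAt_cutoff_scale (s : ℝ) {Λ : ℝ} (hΛ : Λ ≠ 0) :
    HasDerivAt (fun Λ' : ℝ => salmhoferCutoff (s / Λ' ^ 2)) (klWd Λ s) Λ := by
  have hinner : HasDerivAt (fun Λ' : ℝ => s / Λ' ^ 2) (-(2 * s) / Λ ^ 3) Λ := by
    have h := ((hasDerivAt_pow 2 Λ).inv (pow_ne_zero 2 hΛ)).const_mul s
    refine (h.congr_of_eventuallyEq (Filter.Eventually.of_forall fun Λ' => by simp [div_eq_mul_inv])).congr_deriv ?_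
    field_simp
    ring
  have h := (hasDerivAt_salmhoferCutoff (s / Λ ^ 2)).comp Λ hinner
  simpa only [Function.comp_def, klWd] using h

variable {L M : ℕ} (β μ : ℝ) (K : TrigPolyC4v)

/-- **DICTIONARY (slice line)**: the STEP's `Wd t p = ∂_Λ w^K_Λ(p)|_{Λ}` is `klWd Λ (ω_p² + e_K(p)²)` (`Λ ≠ 0`). -/
theorem klfw_Wd_eq_klWd {Λ : ℝ} (hΛ : Λ ≠ 0) (k : FreqMomentum L M) :
    deriv (fun Λ' : ℝ => hubbardCutoffWeightCT L M β μ K Λ' k) Λ = klWd Λ (matsubaraFreq β M k.1 ^ 2 + nambuXiCT L μ K k.2 ^ 2) := by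
  rw [klws_deriv_cutoffWeight_scale_eq L M β μ K hΛ k, klWd]

/-- **Inner support (closed)**: `klWd Λ s = 0` for `s ≤ Λ²/4` (`0 < Λ`). -/
theorem klWd_eq_zero_of_le {Λ : ℝ} (hΛ : 0 < Λ) {s : ℝ} (hs : s ≤ Λ ^ 2 / 4) : klWd Λ s = 0 := by
  unfold klWd
  rw [klfw_deriv_salmhoferCutoff_eq_zero_of_le, zero_mul]
  rw [div_le_iff₀ (by positivity)]
  linarith

/-- **Outer support (closed)**: `klWd Λ s = 0` for `Λ² ≤ s` (`0 < Λ`). -/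
theorem klWd_eq_zero_of_ge {Λ : ℝ} (hΛ : 0 < Λ) {s : ℝ} (hs : Λ ^ 2 ≤ s) : klWd Λ s = 0 := by
  unfold klWd
  rw [klfw_deriv_salmhoferCutoff_eq_zero_of_ge, zero_mul]
  rw [le_div_iff₀ (by positivity)]
  linarith

/-- **Sup**: `|klWd Λ s| ≤ 8/Λ` (`0 < Λ`; `|χ₂′| ≤ 4`, `0 ≤ s ≤ Λ²` on the support). -/
theorem abs_klWd_le {Λ : ℝ} (hΛ : 0 < Λ) (s : ℝ) : |klWd Λ s| ≤ 8 / Λ := by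
  by_cases hs1 : s ≤ Λ ^ 2
  · by_cases hs0 : 0 ≤ s
    · unfold klWd
      rw [abs_mul]
      have h1 : |deriv salmhoferCutoff (s / Λ ^ 2)| ≤ 4 := abs_deriv_salmhoferCutoff_le_four _
      have h2 : |(-(2 * s) / Λ ^ 3)| ≤ 2 / Λ := by
        rw [abs_div, abs_neg, abs_of_nonneg (by positivity : (0 : ℝ) ≤ 2 * s), abs_of_pos (by positivity : (0 : ℝ) < Λ ^ 3),
          div_le_div_iff₀ (by positivity) hΛ]
        nlinarith
      calc |deriv salmhoferCutoff (s / Λ ^ 2)| * |(-(2 * s) / Λ ^ 3)| ≤ 4 * (2 / Λ) :=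
            mul_le_mul h1 h2 (abs_nonneg _) (by norm_num)
        _ = 8 / Λ := by ring
    · rw [klWd_eq_zero_of_le hΛ (by nlinarith [not_le.mp hs0]), abs_zero]
      positivity
  · rw [klWd_eq_zero_of_ge hΛ (not_le.mp hs1).le, abs_zero]
    positivity

/-- `‖klWdC Λ s‖ ≤ 8/Λ`. -/
theorem norm_klWdC_le {Λ : ℝ} (hΛ : 0 < Λ) (s : ℝ) : ‖klWdC Λ s‖ ≤ 8 / Λ := by
  rw [klWdC, Complex.norm_real, Real.norm_eq_abs]; exact abs_klWd_le hΛ s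

/-- The `s`-derivative of `klWd Λ`. -/
theorem klfw_hasDerivAt_klWd (Λ s : ℝ) :
    HasDerivAt (klWd Λ)
      (deriv (deriv salmhoferCutoff) (s / Λ ^ 2) * (1 / Λ ^ 2) * (-(2 * s) / Λ ^ 3) +
        deriv salmhoferCutoff (s / Λ ^ 2) * (-(2 : ℝ) / Λ ^ 3)) s := by
  have h1 : HasDerivAt (fun s : ℝ => deriv salmhoferCutoff (s / Λ ^ 2)) (deriv (deriv salmhoferCutoff) (s / Λ ^ 2) * (1 / Λ ^ 2)) s := by
    have h := (hasDerivAt_deriv_salmhoferCutoff (s / Λ ^ 2)).comp s ((hasDerivAt_id s).div_const (Λ ^ 2))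
    simpa only [Function.comp_def, id] using h
  have h2 : HasDerivAt (fun s : ℝ => -(2 * s) / Λ ^ 3) (-(2 : ℝ) / Λ ^ 3) s := by
    have h := (((hasDerivAt_id s).const_mul 2).neg).div_const (Λ ^ 3)
    simpa using h
  exact h1.mul h2

/-- **Derivative bound**: `|∂_s klWd Λ s| ≤ (2B₂ + 8)/Λ³` with `B₂ = 448e²/3` (`0 < Λ`). -/
theorem abs_deriv_klWd_le {Λ : ℝ} (hΛ : 0 < Λ) (s : ℝ) :
    |deriv (klWd Λ) s| ≤ (2 * (448 / 3 * Real.exp 2) + 8) / Λ ^ 3 := by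
  rw [(klfw_hasDerivAt_klWd Λ s).deriv]
  have hΛ2 : 0 < Λ ^ 2 := by positivity
  have hΛ3 : 0 < Λ ^ 3 := by positivity
  have hB₂ : 0 ≤ 448 / 3 * Real.exp 2 := by positivity
  by_cases hlo : s / Λ ^ 2 < 1 / 4
  · rw [deriv_deriv_salmhoferCutoff_eq_zero_of_lt hlo, deriv_salmhoferCutoff_eq_zero_of_lt hlo]
    simp only [zero_mul, zero_add, abs_zero]
    positivity
  by_cases hhi : 1 < s / Λ ^ 2
  · rw [deriv_deriv_salmhoferCutoff_eq_zero_of_gt hhi, deriv_salmhoferCutoff_eq_zero_of_gt hhi]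
    simp only [zero_mul, zero_add, abs_zero]
    positivity
  have hs0 : 0 ≤ s := by
    have h : 1 / 4 ≤ s / Λ ^ 2 := not_lt.mp hlo
    rw [le_div_iff₀ hΛ2] at h; nlinarith
  have hs1 : s ≤ Λ ^ 2 := by
    have h : s / Λ ^ 2 ≤ 1 := not_lt.mp hhi
    rwa [div_le_iff₀ hΛ2, one_mul] at h
  have hA : |deriv (deriv salmhoferCutoff) (s / Λ ^ 2) * (1 / Λ ^ 2) * (-(2 * s) / Λ ^ 3)| ≤ 2 * (448 / 3 * Real.exp 2) / Λ ^ 3 := by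
    have e1 : |(1 : ℝ) / Λ ^ 2| = 1 / Λ ^ 2 := abs_of_pos (by positivity)
    have e2 : |(-(2 * s) / Λ ^ 3 : ℝ)| = 2 * s / Λ ^ 3 := by
      rw [abs_div, abs_neg, abs_of_nonneg (by positivity : (0 : ℝ) ≤ 2 * s), abs_of_pos hΛ3]
    rw [abs_mul, abs_mul, e1, e2]
    have h1 := klsd_abs_deriv2_salmhoferCutoff_le (s / Λ ^ 2)
    calc |deriv (deriv salmhoferCutoff) (s / Λ ^ 2)| * (1 / Λ ^ 2) * (2 * s / Λ ^ 3)
        ≤ (448 / 3 * Real.exp 2) * (1 / Λ ^ 2) * (2 * Λ ^ 2 / Λ ^ 3) := by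
          refine mul_le_mul (mul_le_mul_of_nonneg_right h1 (by positivity)) ?_ (by positivity) (by positivity)
          exact div_le_div_of_nonneg_right (by nlinarith) hΛ3.le
      _ = 2 * (448 / 3 * Real.exp 2) / Λ ^ 3 := by field_simp
  have hB : |deriv salmhoferCutoff (s / Λ ^ 2) * (-(2 : ℝ) / Λ ^ 3)| ≤ 8 / Λ ^ 3 := by
    rw [abs_mul, abs_div, abs_neg, abs_of_pos hΛ3, Nat.abs_ofNat]
    have h1 := abs_deriv_salmhoferCutoff_le_four (s / Λ ^ 2)
    calc |deriv salmhoferCutoff (s / Λ ^ 2)| * (2 / Λ ^ 3) ≤ 4 * (2 / Λ ^ 3) := mul_le_mul_of_nonneg_right h1 (by positivity)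
      _ = 8 / Λ ^ 3 := by ring
  calc |deriv (deriv salmhoferCutoff) (s / Λ ^ 2) * (1 / Λ ^ 2) * (-(2 * s) / Λ ^ 3) + deriv salmhoferCutoff (s / Λ ^ 2) * (-2 / Λ ^ 3)|
      ≤ |deriv (deriv salmhoferCutoff) (s / Λ ^ 2) * (1 / Λ ^ 2) * (-(2 * s) / Λ ^ 3)| + |deriv salmhoferCutoff (s / Λ ^ 2) * (-2 / Λ ^ 3)| :=
        abs_add_le _ _
    _ ≤ 2 * (448 / 3 * Real.exp 2) / Λ ^ 3 + 8 / Λ ^ 3 := add_le_add hA hB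
    _ = (2 * (448 / 3 * Real.exp 2) + 8) / Λ ^ 3 := by ring

/-- **Lipschitz**: `|klWd Λ s − klWd Λ s′| ≤ ((2B₂+8)/Λ³)·|s − s′|` (`0 < Λ`). -/
theorem klWd_lipschitz {Λ : ℝ} (hΛ : 0 < Λ) (s s' : ℝ) :
    |klWd Λ s - klWd Λ s'| ≤ (2 * (448 / 3 * Real.exp 2) + 8) / Λ ^ 3 * |s - s'| := by
  have hdiff : ∀ x ∈ (Set.univ : Set ℝ), DifferentiableAt ℝ (klWd Λ) x := fun x _ => (klfw_hasDerivAt_klWd Λ x).differentiableAt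
  have hbd : ∀ x ∈ (Set.univ : Set ℝ), ‖deriv (klWd Λ) x‖ ≤ (2 * (448 / 3 * Real.exp 2) + 8) / Λ ^ 3 := fun x _ => by
    rw [Real.norm_eq_abs]; exact abs_deriv_klWd_le hΛ x
  have h := convex_univ.norm_image_sub_le_of_norm_deriv_le hdiff hbd (Set.mem_univ s') (Set.mem_univ s)
  rwa [Real.norm_eq_abs, Real.norm_eq_abs] at h

/-- `‖klWdC Λ s − klWdC Λ s′‖ ≤ ((2B₂+8)/Λ³)·|s − s′|`. -/
theorem klWdC_lipschitz {Λ : ℝ} (hΛ : 0 < Λ) (s s' : ℝ) :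
    ‖klWdC Λ s - klWdC Λ s'‖ ≤ (2 * (448 / 3 * Real.exp 2) + 8) / Λ ^ 3 * |s - s'| := by
  rw [klWdC, klWdC, ← Complex.ofReal_sub, Complex.norm_real, Real.norm_eq_abs]; exact klWd_lipschitz hΛ s s'

/-- `klWdC Λ s = 0` for `s ≤ Λ²/4`. -/
theorem klWdC_eq_zero_of_le {Λ : ℝ} (hΛ : 0 < Λ) {s : ℝ} (hs : s ≤ Λ ^ 2 / 4) : klWdC Λ s = 0 := by
  rw [klWdC, klWd_eq_zero_of_le hΛ hs, Complex.ofReal_zero]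

/-- `klWdC Λ s = 0` for `Λ² ≤ s`. -/
theorem klWdC_eq_zero_of_ge {Λ : ℝ} (hΛ : 0 < Λ) {s : ℝ} (hs : Λ ^ 2 ≤ s) : klWdC Λ s = 0 := by
  rw [klWdC, klWd_eq_zero_of_ge hΛ hs, Complex.ofReal_zero]

/-! ## §2 The running partner symbol `Φ = w_{Λm} − w_Λ` as a function of `s` -/

/-- **`klPhi Λm Λ s = χ₂(s/Λm²) − χ₂(s/Λ²)`** — the weight of the modes between `Λm` and `Λ` (`Λm ≤ Λ`). -/
def klPhi (Λm Λ s : ℝ) : ℝ := salmhoferCutoff (s / Λm ^ 2) - salmhoferCutoff (s / Λ ^ 2)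

/-- The `ℂ`-valued copy. -/
def klPhiC (Λm Λ : ℝ) (s : ℝ) : ℂ := ((klPhi Λm Λ s : ℝ) : ℂ)

/-- `|klPhi Λm Λ s| ≤ 1`. -/
theorem abs_klPhi_le_one (Λm Λ s : ℝ) : |klPhi Λm Λ s| ≤ 1 := abs_sliceCutoff_le_one s Λm Λ

/-- `0 ≤ klPhi Λm Λ s` for `0 < Λm ≤ Λ` (monotone `χ₂`). -/
theorem klPhi_nonneg {Λm Λ : ℝ} (hΛm : 0 < Λm) (hle : Λm ≤ Λ) (s : ℝ) : 0 ≤ klPhi Λm Λ s := by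
  unfold klPhi
  by_cases hs : 0 ≤ s
  · have h : s / Λ ^ 2 ≤ s / Λm ^ 2 :=
      div_le_div_of_nonneg_left hs (by positivity) (pow_le_pow_left₀ hΛm.le hle 2)
    linarith [monotone_salmhoferCutoff h]
  · have h1 : s / Λm ^ 2 ≤ 1 / 4 := (div_nonpos_of_nonpos_of_nonneg (not_le.mp hs).le (by positivity)).trans (by norm_num)
    have h2 : s / Λ ^ 2 ≤ 1 / 4 := (div_nonpos_of_nonpos_of_nonneg (not_le.mp hs).le (by positivity)).trans (by norm_num)
    rw [salmhoferCutoff_of_le h1, salmhoferCutoff_of_le h2, sub_zero]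

/-- **Inner support**: `klPhi Λm Λ s = 0` for `s ≤ Λm²/4` (`0 < Λm ≤ Λ`). -/
theorem klPhi_eq_zero_of_le {Λm Λ : ℝ} (hΛm : 0 < Λm) (hle : Λm ≤ Λ) {s : ℝ} (hs : s ≤ Λm ^ 2 / 4) : klPhi Λm Λ s = 0 :=
  sliceCutoff_eq_zero_of_le hΛm hle hs

/-- **Outer support**: `klPhi Λm Λ s = 0` for `Λ² ≤ s` (`0 < Λm ≤ Λ`). -/
theorem klPhi_eq_zero_of_ge {Λm Λ : ℝ} (hΛm : 0 < Λm) (hle : Λm ≤ Λ) {s : ℝ} (hs : Λ ^ 2 ≤ s) : klPhi Λm Λ s = 0 :=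
  sliceCutoff_eq_zero_of_ge hΛm hle hs

/-- **Lipschitz**: `|klPhi Λm Λ s − klPhi Λm Λ s′| ≤ (8/Λm²)·|s − s′|` (`0 < Λm ≤ Λ`; `|χ₂′| ≤ 4`). -/
theorem klPhi_lipschitz {Λm Λ : ℝ} (hΛm : 0 < Λm) (hle : Λm ≤ Λ) (s s' : ℝ) :
    |klPhi Λm Λ s - klPhi Λm Λ s'| ≤ 8 / Λm ^ 2 * |s - s'| := by
  unfold klPhi
  have hΛ : 0 < Λ := hΛm.trans_le hle
  have hm2 : 0 < Λm ^ 2 := by positivity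
  have hΛ2 : 0 < Λ ^ 2 := by positivity
  have h1 := salmhoferCutoff_lipschitz_four (s / Λm ^ 2) (s' / Λm ^ 2)
  have h2 := salmhoferCutoff_lipschitz_four (s / Λ ^ 2) (s' / Λ ^ 2)
  have e1 : |s / Λm ^ 2 - s' / Λm ^ 2| = (Λm ^ 2)⁻¹ * |s - s'| := by rw [← sub_div, abs_div, abs_of_pos hm2]; ring
  have e2 : |s / Λ ^ 2 - s' / Λ ^ 2| = (Λ ^ 2)⁻¹ * |s - s'| := by rw [← sub_div, abs_div, abs_of_pos hΛ2]; ring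
  rw [e1] at h1
  rw [e2] at h2
  have hinv : (Λ ^ 2)⁻¹ ≤ (Λm ^ 2)⁻¹ := by
    rw [inv_le_inv₀ hΛ2 hm2]; exact pow_le_pow_left₀ hΛm.le hle 2
  have habs : 0 ≤ |s - s'| := abs_nonneg _
  calc |salmhoferCutoff (s / Λm ^ 2) - salmhoferCutoff (s / Λ ^ 2) - (salmhoferCutoff (s' / Λm ^ 2) - salmhoferCutoff (s' / Λ ^ 2))|
      = |(salmhoferCutoff (s / Λm ^ 2) - salmhoferCutoff (s' / Λm ^ 2)) - (salmhoferCutoff (s / Λ ^ 2) - salmhoferCutoff (s' / Λ ^ 2))| := by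
        ring_nf
    _ ≤ |salmhoferCutoff (s / Λm ^ 2) - salmhoferCutoff (s' / Λm ^ 2)| + |salmhoferCutoff (s / Λ ^ 2) - salmhoferCutoff (s' / Λ ^ 2)| :=
        abs_sub _ _
    _ ≤ 4 * ((Λm ^ 2)⁻¹ * |s - s'|) + 4 * ((Λ ^ 2)⁻¹ * |s - s'|) := add_le_add h1 h2
    _ ≤ 4 * ((Λm ^ 2)⁻¹ * |s - s'|) + 4 * ((Λm ^ 2)⁻¹ * |s - s'|) := by nlinarith
    _ = 8 / Λm ^ 2 * |s - s'| := by ring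

/-- `‖klPhiC Λm Λ s‖ ≤ 1`. -/
theorem norm_klPhiC_le_one (Λm Λ s : ℝ) : ‖klPhiC Λm Λ s‖ ≤ 1 := by
  rw [klPhiC, Complex.norm_real, Real.norm_eq_abs]; exact abs_klPhi_le_one Λm Λ s

/-- `‖klPhiC Λm Λ s − klPhiC Λm Λ s′‖ ≤ (8/Λm²)·|s − s′|`. -/
theorem klPhiC_lipschitz {Λm Λ : ℝ} (hΛm : 0 < Λm) (hle : Λm ≤ Λ) (s s' : ℝ) :
    ‖klPhiC Λm Λ s - klPhiC Λm Λ s'‖ ≤ 8 / Λm ^ 2 * |s - s'| := by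
  rw [klPhiC, klPhiC, ← Complex.ofReal_sub, Complex.norm_real, Real.norm_eq_abs]; exact klPhi_lipschitz hΛm hle s s'

/-- `klPhiC Λm Λ s = 0` for `s ≤ Λm²/4`. -/
theorem klPhiC_eq_zero_of_le {Λm Λ : ℝ} (hΛm : 0 < Λm) (hle : Λm ≤ Λ) {s : ℝ} (hs : s ≤ Λm ^ 2 / 4) : klPhiC Λm Λ s = 0 := by
  rw [klPhiC, klPhi_eq_zero_of_le hΛm hle hs, Complex.ofReal_zero]

/-- `klPhiC Λm Λ s = 0` for `Λ² ≤ s`. -/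
theorem klPhiC_eq_zero_of_ge {Λm Λ : ℝ} (hΛm : 0 < Λm) (hle : Λm ≤ Λ) {s : ℝ} (hs : Λ ^ 2 ≤ s) : klPhiC Λm Λ s = 0 := by
  rw [klPhiC, klPhi_eq_zero_of_ge hΛm hle hs, Complex.ofReal_zero]

/-- **The deep/near split** (telescoping): `klPhi Λj Λ = klPhi Λj Λm + klPhi Λm Λ`. -/
theorem klPhi_split (Λj Λm Λ s : ℝ) : klPhi Λj Λ s = klPhi Λj Λm s + klPhi Λm Λ s := by
  unfold klPhi; ring

/-- **DICTIONARY (complementary symbol)**: `s^K_{n,m}(k) = klPhi Λ_m Λ_n (ω_k² + e_K(k)²)`. -/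
theorem klfw_softSymbolCompl_eq (n m : ℕ) (k : FreqMomentum L M) :
    softSymbolCompl L M β μ K n m k = klPhi (klScale klE0 m) (klScale klE0 n) (matsubaraFreq β M k.1 ^ 2 + nambuXiCT L μ K k.2 ^ 2) := by
  unfold softSymbolCompl klPhi hubbardCutoffWeightCT; rfl

/-- **DICTIONARY (member symbol)**: the STEP's running partner `Φ_j(t)(k) = s^K_{n+1,j}(k) + (w^K_{Λₙ₊₁}(k) − w^K_{Λ}(k)) = klPhi Λ_j Λ (ω² + e_K²)`. -/
theorem klfw_memberSymbol_eq (n j : ℕ) (Λ : ℝ) (k : FreqMomentum L M) :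
    softSymbolCompl L M β μ K (n + 1) j k +
        (hubbardCutoffWeightCT L M β μ K (klScale klE0 (n + 1)) k - hubbardCutoffWeightCT L M β μ K Λ k) =
      klPhi (klScale klE0 j) Λ (matsubaraFreq β M k.1 ^ 2 + nambuXiCT L μ K k.2 ^ 2) := by
  unfold softSymbolCompl klPhi hubbardCutoffWeightCT; ring

/-- **DICTIONARY (`D`-line)**: `s^K_{n+1,j} − s^K_{n+1,j′} = klPhi Λ_j Λ_{j′} (ω² + e_K²)` (`= s^K_{j′,j}`). -/
theorem klfw_dLine_eq (n j j' : ℕ) (k : FreqMomentum L M) :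
    softSymbolCompl L M β μ K (n + 1) j k - softSymbolCompl L M β μ K (n + 1) j' k =
      klPhi (klScale klE0 j) (klScale klE0 j') (matsubaraFreq β M k.1 ^ 2 + nambuXiCT L μ K k.2 ^ 2) := by
  unfold softSymbolCompl klPhi hubbardCutoffWeightCT; ring

/-- The member symbol of `j ≥ n+2` splits into the `D`-line of the pair `(j, n+2)` plus the NEAR partner `Φ_{n+2}(t)`:
`klPhi Λ_j Λ = s^K_{n+2,j}(k)·[as klPhi Λ_j Λ_{n+2}] + klPhi Λ_{n+2} Λ`. -/
theorem klfw_memberSymbol_split (n j : ℕ) (Λ : ℝ) (k : FreqMomentum L M) :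
    klPhi (klScale klE0 j) Λ (matsubaraFreq β M k.1 ^ 2 + nambuXiCT L μ K k.2 ^ 2) =
      softSymbolCompl L M β μ K (n + 2) j k + klPhi (klScale klE0 (n + 2)) Λ (matsubaraFreq β M k.1 ^ 2 + nambuXiCT L μ K k.2 ^ 2) := by
  rw [klfw_softSymbolCompl_eq, ← klPhi_split]

/-! ## §3 At the rows' scale index `n+1`: `Λ(t) ∈ [Λₙ₊₁, Λₙ] = [Λₙ₊₁, 4Λₙ₊₁]` -/

section Scale

variable {n : ℕ} {Λ : ℝ} (hlo : klScale klE0 (n + 1) ≤ Λ) (hhi : Λ ≤ klScale klE0 n)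
include hlo hhi

omit hlo hhi in
/-- `Λₙ = 4Λₙ₊₁`. -/
theorem klfw_scale_eq_four_mul (n : ℕ) : klScale klE0 n = 4 * klScale klE0 (n + 1) := by
  rw [klth_klScale_succ]; ring

omit hlo hhi in
/-- `Λₙ₊₁/Λ_m = 4^{m−(n+1)}` for `n+1 ≤ m`, as `Λₙ₊₁ = 4^{m−(n+1)}·Λ_m`. -/
theorem klfw_scale_ratio {m : ℕ} (hm : n + 1 ≤ m) : klScale klE0 (n + 1) = (4 : ℝ) ^ (m - (n + 1)) * klScale klE0 m := by
  unfold klScale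
  obtain ⟨d, rfl⟩ := Nat.exists_eq_add_of_le hm
  rw [Nat.add_sub_cancel_left]
  field_simp
  ring

/-- **THE SLICE WEIGHT `f = klWdC Λ(t)` MEETS THE FOUR ROW HYPOTHESES AT INDEX `n+1`** with `M_f = 8/Λₙ₊₁` and Lipschitz constant
`((2B₂+8)/Λₙ₊₁)/Λₙ₊₁²` (i.e. `ℓ_f = (2B₂+8)/Λₙ₊₁`, `B₂ = 448e²/3`): sup, Lipschitz, `f = 0` for `s ≤ (Λₙ₊₁/2)²` and for `(4Λₙ₊₁)² ≤ s`. -/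
theorem klfw_sliceWeight_hypotheses :
    (∀ s, ‖klWdC Λ s‖ ≤ 8 / klScale klE0 (n + 1)) ∧
    (∀ s s', ‖klWdC Λ s - klWdC Λ s'‖ ≤ ((2 * (448 / 3 * Real.exp 2) + 8) / klScale klE0 (n + 1)) / klScale klE0 (n + 1) ^ 2 * |s - s'|) ∧
    (∀ s, s ≤ (klScale klE0 (n + 1) / 2) ^ 2 → klWdC Λ s = 0) ∧
    (∀ s, (4 * klScale klE0 (n + 1)) ^ 2 ≤ s → klWdC Λ s = 0) := by
  have hΛ1 := klth_klScale_pos (n + 1)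
  have hΛ : 0 < Λ := hΛ1.trans_le hlo
  have hB : 0 ≤ 2 * (448 / 3 * Real.exp 2) + 8 := by positivity
  have hsq : klScale klE0 (n + 1) ^ 2 ≤ Λ ^ 2 := pow_le_pow_left₀ hΛ1.le hlo 2
  refine ⟨fun s => (norm_klWdC_le hΛ s).trans (div_le_div_of_nonneg_left (by norm_num) hΛ1 hlo), fun s s' => ?_, fun s hs => ?_, fun s hs => ?_⟩
  · refine (klWdC_lipschitz hΛ s s').trans (mul_le_mul_of_nonneg_right ?_ (abs_nonneg _))
    rw [div_div, ← pow_succ', div_le_div_iff₀ (by positivity) (by positivity)]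
    exact mul_le_mul_of_nonneg_left (pow_le_pow_left₀ hΛ1.le hlo 3) hB
  · exact klWdC_eq_zero_of_le hΛ (hs.trans (by rw [div_pow]; linarith))
  · refine klWdC_eq_zero_of_ge hΛ (le_trans ?_ hs)
    rw [← klfw_scale_eq_four_mul n]; exact pow_le_pow_left₀ hΛ.le hhi 2

/-- **THE PARTNER `d = klPhiC Λ_m Λ(t)`, `n+1 ≤ m`, MEETS THE ROW HYPOTHESES AT INDEX `n+1`**: `‖d‖ ≤ 1`, Lipschitz `8/Λ_m²`, `d = 0` for
`(4Λₙ₊₁)² ≤ s` (and for `s ≤ (Λ_m/2)²`). -/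
theorem klfw_partner_hypotheses {m : ℕ} (hm : n + 1 ≤ m) :
    (∀ s, ‖klPhiC (klScale klE0 m) Λ s‖ ≤ 1) ∧
    (∀ s s', ‖klPhiC (klScale klE0 m) Λ s - klPhiC (klScale klE0 m) Λ s'‖ ≤ 8 / klScale klE0 m ^ 2 * |s - s'|) ∧
    (∀ s, (4 * klScale klE0 (n + 1)) ^ 2 ≤ s → klPhiC (klScale klE0 m) Λ s = 0) ∧
    (∀ s, s ≤ (klScale klE0 m / 2) ^ 2 → klPhiC (klScale klE0 m) Λ s = 0) := by
  have hΛm := klth_klScale_pos m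
  have hΛ : 0 < Λ := (klth_klScale_pos (n + 1)).trans_le hlo
  have hanti : klScale klE0 m ≤ klScale klE0 (n + 1) := by
    unfold klScale
    exact mul_le_mul_of_nonneg_left (inv_anti₀ (by positivity) (pow_le_pow_right₀ (by norm_num) hm)) (by unfold klE0; norm_num)
  have hmle : klScale klE0 m ≤ Λ := hanti.trans hlo
  refine ⟨fun s => norm_klPhiC_le_one _ _ s, fun s s' => klPhiC_lipschitz hΛm hmle s s', fun s hs => ?_, fun s hs => ?_⟩
  · refine klPhiC_eq_zero_of_ge hΛm hmle (le_trans ?_ hs)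
    rw [← klfw_scale_eq_four_mul n]; exact pow_le_pow_left₀ hΛ.le hhi 2
  · exact klPhiC_eq_zero_of_le hΛm hmle (hs.trans (by rw [div_pow]; norm_num))

omit hlo hhi in
/-- The partner's Lipschitz constant in the rows' form `L_d ≤ ℓ′/Λₙ₊₁²` with `ℓ′ = 8·16^{m−(n+1)}`. -/
theorem klfw_partner_lipschitz_scale {m : ℕ} (hm : n + 1 ≤ m) :
    8 / klScale klE0 m ^ 2 = 8 * (16 : ℝ) ^ (m - (n + 1)) / klScale klE0 (n + 1) ^ 2 := by
  have hΛm := klth_klScale_pos m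
  rw [klfw_scale_ratio hm, mul_pow, ← pow_mul, show (16 : ℝ) = 4 ^ 2 by norm_num, ← pow_mul, mul_comm 2 (m - (n + 1))]
  field_simp

/-- **THE PRODUCT WEIGHT `F = f·d`** (zero-transfer part of the rows): `‖F‖ ≤ 8/Λₙ₊₁` and `F` is
`(8/Λₙ₊₁·8/Λ_m² + (2B₂+8)/Λₙ₊₁³)`-Lipschitz. -/
theorem klfw_product_hypotheses {m : ℕ} (hm : n + 1 ≤ m) :
    (∀ s, ‖klWdC Λ s * klPhiC (klScale klE0 m) Λ s‖ ≤ 8 / klScale klE0 (n + 1)) ∧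
    (∀ s s', ‖klWdC Λ s * klPhiC (klScale klE0 m) Λ s - klWdC Λ s' * klPhiC (klScale klE0 m) Λ s'‖ ≤
      (8 / klScale klE0 (n + 1) * (8 / klScale klE0 m ^ 2) + 1 * (((2 * (448 / 3 * Real.exp 2) + 8) / klScale klE0 (n + 1)) / klScale klE0 (n + 1) ^ 2)) *
        |s - s'|) := by
  obtain ⟨hbd, hlip, -, -⟩ := klfw_sliceWeight_hypotheses hlo hhi
  obtain ⟨hdbd, hdlip, -, -⟩ := klfw_partner_hypotheses hlo hhi hm
  exact ⟨fun s => klwt_mul_norm_le hbd hdbd s |>.trans (by rw [mul_one]), fun s s' => klwt_mul_lipschitz hbd hdbd hlip hdlip s s'⟩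

end Scale

end Summit.HubbardSuperconductivity.HubbardSuperconductivity.Theorems.KLRegimeSplit

end
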